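import Mathlib
import Summits.RiemannHypothesis.RiemannHypothesis.Theorems.WeilFarFloorSecondOrderUpperRH
import Summits.RiemannHypothesis.RiemannHypothesis.Theorems.WeilFarFloorCoshQuotientLowerRH
import HarnessLib

/-!
# ★ The second-order law of the far-coercivity floor, UPPER half: `λ_max(a) ≤ R_c(a) + (1+ε)·J(a)/R_c(a) + ε·e^{−a}` under RH

Helper file (`--supports stmt-RiemannHypothesis-0098`, lead-track anchor: Weil-positivity window ladder, format-C far bound),
pure proofs.  Seat rh-explicit-weil-1 gen15 (memo `run/shared/lean/pub/rh-explicit/rh-explicit-weil-1/FORMAT-K3.md` §16;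
`FLOOR-LAW-STATUS.md` rev 21).

THE OBJECTS.  `λ_max(a) = farCoercivityFloor a` (the least uniform far constant of the window `[−a, a]`), `C_a = 1_{[−a,a]}cosh(·/2)`
the cosh profile (`‖C_a‖² = a + sinh a`), `R_c(a) = Q_a(C_a)/(a + sinh a)` its Rayleigh quotient, and the RESIDUAL ENERGY
`J(a) = ‖1_{(−a,a)}(T_aC_a − R_c(a)C_a)‖²/(a + sinh a)` — the squared coupling of the profile to its orthogonal complement, an
explicit finite prime sum (`T_a` the prime-shift operator; `J(a) ≈ 1.4 + 2a(β_F + W(a))`, memo §15.5).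

THE THEOREM (`farCoercivityFloor_le_coshQuotient_add_secondOrder_of_RH`):
  **`RiemannHypothesis → ∀ ε > 0, ∃ a₀, ∀ a ≥ a₀:  λ_max(a) ≤ R_c(a) + (1 + ε)·J(a)/R_c(a) + ε·e^{−a}`.**
With the RH-free LOWER half `λ_max(a) ≥ R_c(a) + (J(a)/R_c(a))·(1 + Q_a(r)/(ρR_c))/(1 + J/R_c²)` (`WeilFarFloorSecondOrderLower`,
p396274) this pins the floor gap `λ_max − R_c` to the second-order perturbation coefficient `J/R_c ≍ J(a)·e^{−a}` of the cosh
profile, up to the factor `1 + ε` above and the relative size `Q_a(r)/(ρR_c)` of the residual's own form below (computed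
`0.086 → 0.0016` for `a = 2 … 8`, memo §15.8; measured law `gap(a)·e^a ∈ [2.1, 2.4]` on `5 ≤ a ≤ 8`, §15.9).  Earlier kernel
rates: `C(a+2)⁵e^{−a}` (von Koch, `WeilFarFloorCoshOptimalRateRH`), `C(a+2)e^{−a}` (Cramér, staged); here the COEFFICIENT is identified.
PROOF.  `farCoercivityFloor_le_coshQuotient_secondOrder_of_RH` (box envelope → nearby Weil test → exact `2 × 2` block along the
mollified profile inside the enlarged window) with `λ₀ = R_c(a)`, `J_c = J(a)`, budgets `h = e^{−4a}`, `s = e^{−3a}`, `η = e^{−2a}`,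
`W = τ = 38(e^{a+h+1}+1)`, `P₊ = (a+h+1) + sinh(a+h+1)`: `6Ws + 11η ≤ (456e² + 11)e^{−2a}`, `e₁ ≤ 380e²·e^{−a}`, `L ≤ 12a + 11`
against `R_c(a) ≥ e^a − C_q(a³ + 1)` (`coshQuotient_ge_of_RH`), and `(√J + e₁)²/((1−3s)(R − L)) ≤ (1 + 3δ)J/R + (3/δ)e₁²/R` once
`12s ≤ δ`, `3L ≤ δR`; every threshold is an instance of `(a³ + 1)e^{−a} → 0`.  Standard axioms only; RH enters as Mathlib's
`RiemannHypothesis`.  Nothing here bears on the truth of RH.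
-/

set_option linter.dupNamespace false
set_option autoImplicit false

noncomputable section

open MeasureTheory Set Filter
open scoped Real Topology ArithmeticFunction.vonMangoldt

namespace Summit.RiemannHypothesis.RiemannHypothesis.Theorems.WeilFormatC

namespace FloorCoshSplit

open Literature.NumberTheory.LFunctions FloorCosh FloorEnvelope

/-! ## §1 The asymptotic bookkeeping of the block bound -/

/-- **Bookkeeping.**  For `0 < δ ≤ 1/3`, `J ≥ 0`, `12s ≤ δ`, `3L ≤ δR`, `R > 0`:
`(√J + e₁)²/((1 − 3s)(R − L)) ≤ (1 + 3δ)·J/R + (3/δ)·e₁²/R` (Young on the cross term; `(1+δ)(1−3s)(1 − L/R) ≥ 1`). -/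
theorem secondOrder_asymptotic_bookkeeping {R J L s e₁ δ : ℝ} (hδ0 : 0 < δ) (hδ1 : δ ≤ 1 / 3) (hJ : 0 ≤ J)
    (hs : 12 * s ≤ δ) (hL : 3 * L ≤ δ * R) (hR0 : 0 < R) :
    (Real.sqrt J + e₁) ^ 2 / ((1 - 3 * s) * (R - L)) ≤ (1 + 3 * δ) * J / R + 3 / δ * e₁ ^ 2 / R := by
  set j := Real.sqrt J with hj
  have hj0 : 0 ≤ j := Real.sqrt_nonneg _
  have hjJ : j ^ 2 = J := Real.sq_sqrt hJ
  -- Young: `(j + e₁)² ≤ (1+δ)j² + (1 + 1/δ)e₁²`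
  have hY : (j + e₁) ^ 2 ≤ (1 + δ) * J + (1 + 1 / δ) * e₁ ^ 2 := by
    have h0 : 0 ≤ (δ * j - e₁) ^ 2 := sq_nonneg _
    have h1 : 2 * j * e₁ * δ ≤ δ ^ 2 * j ^ 2 + e₁ ^ 2 := by nlinarith only [h0]
    have h2 : 2 * j * e₁ ≤ δ * j ^ 2 + e₁ ^ 2 / δ := by
      have e : δ * j ^ 2 + e₁ ^ 2 / δ = (δ ^ 2 * j ^ 2 + e₁ ^ 2) / δ := by field_simp
      rw [e, le_div_iff₀ hδ0]; linarith only [h1]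
    have e2 : (1 + 1 / δ) * e₁ ^ 2 = e₁ ^ 2 + e₁ ^ 2 / δ := by field_simp
    rw [e2, ← hjJ]; nlinarith only [h2]
  -- the denominator: `R ≤ (1+δ)(1−3s)(R−L)`
  have h3s : 0 < 1 - 3 * s := by linarith only [hs, hδ1]
  have hRL : 0 < R - L := by nlinarith only [hL, hδ1, hR0]
  have hden0 : 0 < (1 - 3 * s) * (R - L) := mul_pos h3s hRL
  have hden : R ≤ (1 + δ) * ((1 - 3 * s) * (R - L)) := by
    -- `(1−3s) ≥ 1 − δ/4`, `R − L ≥ (1 − δ/3)R`, `(1+δ)(1−δ/4)(1−δ/3) ≥ 1` for `δ ≤ 1/3`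
    have h1 : 1 - δ / 4 ≤ 1 - 3 * s := by linarith only [hs]
    have h2 : (1 - δ / 3) * R ≤ R - L := by nlinarith only [hL]
    have h14 : 0 ≤ 1 - δ / 4 := by linarith only [hδ1]
    have h13 : 0 ≤ (1 - δ / 3) * R := by nlinarith only [hδ1, hR0]
    have h3 : (1 - δ / 4) * ((1 - δ / 3) * R) ≤ (1 - 3 * s) * (R - L) := mul_le_mul h1 h2 h13 h3s.le
    have h4 : R ≤ (1 + δ) * ((1 - δ / 4) * ((1 - δ / 3) * R)) := by
      have : 0 ≤ (5 - 6 * δ + δ ^ 2) * δ * R := by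
        have : 0 ≤ 5 - 6 * δ + δ ^ 2 := by nlinarith only [hδ0, hδ1]
        positivity
      nlinarith only [this]
    have h5 := mul_le_mul_of_nonneg_left h3 (by linarith only [hδ0] : (0 : ℝ) ≤ 1 + δ)
    exact h4.trans h5
  -- `num/den ≤ (1+δ)·num/R`
  have hnum0 : 0 ≤ (j + e₁) ^ 2 := sq_nonneg _
  have hstep : (j + e₁) ^ 2 / ((1 - 3 * s) * (R - L)) ≤ (1 + δ) * ((1 + δ) * J + (1 + 1 / δ) * e₁ ^ 2) / R := by
    rw [div_le_div_iff₀ hden0 hR0]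
    have h1 : (j + e₁) ^ 2 * R ≤ (j + e₁) ^ 2 * ((1 + δ) * ((1 - 3 * s) * (R - L))) :=
      mul_le_mul_of_nonneg_left hden hnum0
    have h2 : (j + e₁) ^ 2 * ((1 + δ) * ((1 - 3 * s) * (R - L)))
        ≤ ((1 + δ) * J + (1 + 1 / δ) * e₁ ^ 2) * ((1 + δ) * ((1 - 3 * s) * (R - L))) :=
      mul_le_mul_of_nonneg_right hY (by positivity)
    have e : (1 + δ) * ((1 + δ) * J + (1 + 1 / δ) * e₁ ^ 2) * ((1 - 3 * s) * (R - L))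
        = ((1 + δ) * J + (1 + 1 / δ) * e₁ ^ 2) * ((1 + δ) * ((1 - 3 * s) * (R - L))) := by ring
    rw [e]; exact h1.trans h2
  -- constants: `(1+δ)² ≤ 1 + 3δ`, `(1+δ)(1 + 1/δ) ≤ 3/δ`
  have hc1 : (1 + δ) * (1 + δ) ≤ 1 + 3 * δ := by nlinarith only [hδ0, hδ1]
  have hc2 : (1 + δ) * (1 + 1 / δ) ≤ 3 / δ := by
    rw [show (1 + δ) * (1 + 1 / δ) = (1 + δ) * (δ + 1) / δ by field_simp]
    rw [div_le_div_iff_of_pos_right hδ0]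
    nlinarith only [hδ0, hδ1]
  have hfin : (1 + δ) * ((1 + δ) * J + (1 + 1 / δ) * e₁ ^ 2) / R ≤ (1 + 3 * δ) * J / R + 3 / δ * e₁ ^ 2 / R := by
    rw [← add_div]
    refine div_le_div_of_nonneg_right ?_ hR0.le
    have h1 : (1 + δ) * (1 + δ) * J ≤ (1 + 3 * δ) * J := mul_le_mul_of_nonneg_right hc1 hJ
    have h2 : (1 + δ) * (1 + 1 / δ) * e₁ ^ 2 ≤ 3 / δ * e₁ ^ 2 := mul_le_mul_of_nonneg_right hc2 (sq_nonneg _)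
    nlinarith only [h1, h2]
  exact hstep.trans hfin

/-! ## §2 The budgets at `h = e^{−4a}`, `s = e^{−3a}`, `η = e^{−2a}` and the theorem -/

/-- ★★★ **THE SECOND-ORDER LAW, UPPER HALF (under RH).**  For every `ε > 0`, eventually in `a`:
`λ_max(a) ≤ R_c(a) + (1 + ε)·J(a)/R_c(a) + ε·e^{−a}`, where `R_c(a) = Q_a(C_a)/(a + sinh a)` is the cosh quotient and
`J(a) = (∫_{(−a,a)} (T_aC_a − R_c(a)C_a)²)/(a + sinh a)` the residual energy of the cosh profile `C_a = 1_{[−a,a]}cosh(·/2)`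
under the prime-shift operator `(T_af)(x) = Σ_{log n < 2a} (Λ(n)/√n)(f(x − log n) + f(x + log n))`. -/
theorem farCoercivityFloor_le_coshQuotient_add_secondOrder_of_RH (hRH : RiemannHypothesis) {ε : ℝ} (hε : 0 < ε) :
    ∃ a₀ : ℝ, ∀ a : ℝ, a₀ ≤ a →
      farCoercivityFloor a
        ≤ primeShiftForm a ((Icc (-a) a).indicator (fun y ↦ Real.cosh (y / 2))) / (a + Real.sinh a)
          + (1 + ε)
            * ((∫ x in Ioo (-a) a,
                ((∑ n ∈ weilPrimeIndex a, (Λ n : ℝ) / Real.sqrt n *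
                    ((Icc (-a) a).indicator (fun y ↦ Real.cosh (y / 2)) (x - Real.log n)
                      + (Icc (-a) a).indicator (fun y ↦ Real.cosh (y / 2)) (x + Real.log n)))
                  - primeShiftForm a ((Icc (-a) a).indicator (fun y ↦ Real.cosh (y / 2))) / (a + Real.sinh a)
                    * (Icc (-a) a).indicator (fun y ↦ Real.cosh (y / 2)) x) ^ 2) / (a + Real.sinh a))
            / (primeShiftForm a ((Icc (-a) a).indicator (fun y ↦ Real.cosh (y / 2))) / (a + Real.sinh a))
          + ε * Real.exp (-a) := by
  classical
  obtain ⟨Cq, hCq0, hRlow⟩ := coshQuotient_ge_of_RH hRH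
  -- `ε' = min ε 1`, `δ = ε'/3`
  set ε' := min ε 1 with hε'
  have hε'0 : 0 < ε' := lt_min hε one_pos
  have hε'1 : ε' ≤ 1 := min_le_right _ _
  have hε'ε : ε' ≤ ε := min_le_left _ _
  set δ := ε' / 3 with hδ
  have hδ0 : 0 < δ := by rw [hδ]; positivity
  have hδ1 : δ ≤ 1 / 3 := by rw [hδ]; linarith only [hε'1]
  set κ := 380 * Real.exp 2 with hκ
  have hκ0 : 0 < κ := by rw [hκ]; positivity
  have he8 : Real.exp 2 < 8 := by
    have := Real.exp_one_lt_d9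
    have e : Real.exp 2 = Real.exp 1 * Real.exp 1 := by rw [← Real.exp_add]; norm_num
    rw [e]; nlinarith only [this, Real.exp_pos (1:ℝ)]
  have hκ2 : κ ^ 2 ≤ 10 ^ 7 := by
    have h1 : κ ≤ 3040 := by rw [hκ]; linarith only [he8]
    nlinarith only [h1, hκ0]
  set c := ε' * δ / (10 ^ 9 * (Cq + 1)) with hc
  have hD0 : 0 < (10 : ℝ) ^ 9 * (Cq + 1) := by positivity
  have hc0 : 0 < c := by rw [hc]; positivity
  have hεδ1 : ε' * δ ≤ 1 := by nlinarith only [hε'0, hε'1, hδ0, hδ1]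
  have hc2 : c ≤ ε' * δ / 10 ^ 9 := by
    rw [hc]; exact div_le_div_of_nonneg_left (by positivity) (by norm_num) (by nlinarith only [hCq0])
  have hCqc : Cq * c ≤ 1 / 10 ^ 9 := by
    have e : (Cq + 1) * c = ε' * δ / 10 ^ 9 := by rw [hc]; field_simp
    have h1 : Cq * c ≤ (Cq + 1) * c := by nlinarith only [hc0]
    rw [e] at h1
    have h2 : ε' * δ / 10 ^ 9 ≤ 1 / 10 ^ 9 := div_le_div_of_nonneg_right hεδ1 (by norm_num)
    exact h1.trans h2
  have hΦ : Tendsto (fun a : ℝ ↦ (a ^ 3 + 1) * Real.exp (-a)) atTop (𝓝 0) := by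
    have h := (Real.tendsto_pow_mul_exp_neg_atTop_nhds_zero 3).add Real.tendsto_exp_neg_atTop_nhds_zero
    rw [add_zero] at h
    exact h.congr' (Eventually.of_forall fun a ↦ by ring)
  obtain ⟨a₁, ha₁⟩ := Filter.eventually_atTop.1 (hΦ.eventually (Iio_mem_nhds hc0))
  refine ⟨max a₁ 4, fun a ha ↦ ?_⟩
  have ha4 : 4 ≤ a := le_trans (le_max_right _ _) ha
  have hΦa : (a ^ 3 + 1) * Real.exp (-a) < c := ha₁ a (le_trans (le_max_left _ _) ha)
  /- ─── the scales ─── -/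
  set X := Real.exp a with hX
  set t := Real.exp (-a) with ht
  have hX0 : 0 < X := Real.exp_pos _
  have ht0 : 0 < t := Real.exp_pos _
  have hXt : X * t = 1 := by rw [hX, ht, ← Real.exp_add]; simp
  have ht1 : t ≤ 1 := by rw [ht]; exact Real.exp_le_one_iff.2 (by linarith only [ha4])
  have hX1 : 1 ≤ X := by rw [hX]; exact Real.one_le_exp (by linarith only [ha4])
  have haX : a + 1 ≤ X := by rw [hX]; exact Real.add_one_le_exp a
  have ha1 : 1 ≤ a := by linarith only [ha4]
  have ha3 : a ≤ a ^ 3 := le_self_pow₀ ha1 (by norm_num)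
  have ha31 : (1 : ℝ) ≤ a ^ 3 + 1 := by linarith only [pow_nonneg (zero_le_one.trans ha1) 3]
  have htX : t = 1 / X := by field_simp; linarith only [hXt]
  have hct : (a ^ 3 + 1) * t < c := hΦa
  have htc : t < c := lt_of_le_of_lt (le_mul_of_one_le_left ht0.le ha31) hct
  have hc1 : c ≤ ε' * δ / 2000 := hc2.trans (div_le_div_of_nonneg_left (by positivity) (by norm_num) (by norm_num))
  have hcsmall : c ≤ 1 / 2000 := by linarith only [hc1, hεδ1]
  set s := t ^ 3 with hs
  set h := t ^ 4 with hh
  set η := t ^ 2 with hη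
  have hs0 : 0 < s := by positivity
  have hh0 : 0 < h := by positivity
  have hη0 : 0 < η := by positivity
  have hst : s ≤ t := by rw [hs]; exact pow_le_of_le_one ht0.le ht1 (by norm_num)
  have hηt : η ≤ t := by rw [hη]; exact pow_le_of_le_one ht0.le ht1 (by norm_num)
  have hht : h ≤ t := by rw [hh]; exact pow_le_of_le_one ht0.le ht1 (by norm_num)
  have hst2 : s ≤ t ^ 2 := by rw [hs]; exact pow_le_pow_of_le_one ht0.le ht1 (by norm_num)
  have hh1 : h ≤ 1 := hht.trans ht1
  have hη1 : η ≤ 1 := hηt.trans ht1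
  have hs1 : s ≤ 1 / 6 := by linarith only [hst, htc, hcsmall]
  have hsh : s ^ 2 ≤ h := by rw [hs, hh, ← pow_mul]; exact pow_le_pow_of_le_one ht0.le ht1 (by norm_num)
  /- ─── the window quantities ─── -/
  set P := a + Real.sinh a with hP
  have hsinh : Real.sinh a ≤ X / 2 := by
    rw [Real.sinh_eq, hX]; linarith only [Real.exp_pos (-a)]
  have hsinh0 : 0 < Real.sinh a := Real.sinh_pos_iff.2 (by linarith only [ha4])
  have hP0 : 0 < P := by rw [hP]; linarith only [hsinh0, ha4]
  have hPX : P + 3 ≤ 5 * X := by rw [hP]; linarith only [hsinh, haX, hX1]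
  set C : ℝ → ℝ := (Icc (-a) a).indicator (fun y ↦ Real.cosh (y / 2)) with hCdef
  set R := primeShiftForm a C / P with hR
  -- `R ≥ X − C_q(a³+1) ≥ X/2`
  have hRlo : X - Cq * (a ^ 3 + 1) ≤ R := by rw [hR, hP, hCdef, hX]; exact hRlow a ha1
  have hCqt : Cq * (a ^ 3 + 1) ≤ X / 2000 := by
    -- `Cq(a³+1) = Cq·(a³+1)t·X ≤ Cq·c·X ≤ X/2000`
    have h1 : Cq * (a ^ 3 + 1) = Cq * ((a ^ 3 + 1) * t) * X := by
      rw [htX]; field_simp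
    rw [h1]
    have h2 : Cq * ((a ^ 3 + 1) * t) ≤ Cq * c := mul_le_mul_of_nonneg_left hct.le hCq0
    have h3 : Cq * c ≤ 1 / 2000 := hCqc.trans (by norm_num)
    nlinarith only [h2, h3, hX0]
  have hRX : X / 2 ≤ R := by linarith only [hRlo, hCqt, hX0]
  have hR0 : 0 < R := by linarith only [hRX, hX0]
  /- ─── the budgets `W, τ, P₊` ─── -/
  set W := 38 * (Real.exp (a + h + 1) + 1) with hW
  have hWsum : ∑ n ∈ weilPrimeIndex (a + h + 1), 2 * ((Λ n : ℝ) / Real.sqrt n) ≤ W := by rw [hW]; exact weightSum_le _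
  have hW0 : 0 ≤ W := by rw [hW]; positivity
  have hWX : W ≤ 76 * Real.exp 2 * X := by
    have h1 : Real.exp (a + h + 1) ≤ Real.exp (a + 2) := Real.exp_le_exp.2 (by linarith only [hh1])
    have h2 : Real.exp (a + 2) = X * Real.exp 2 := by rw [hX, ← Real.exp_add]
    have h3 : 1 ≤ X * Real.exp 2 := by nlinarith only [hX1, Real.add_one_le_exp (2:ℝ)]
    rw [hW]; nlinarith only [h1, h2, h3]
  have hRW : R ≤ W := by
    obtain ⟨hCm, hCb, hCs⟩ := coshTest_admissible a
    have h1 := primeShiftForm_le_weightSum_mul (a := a) hCm hCb hCs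
    rw [← hCdef, integral_coshTest_sq (by linarith only [ha4] : (0:ℝ) ≤ a), ← hP] at h1
    have h2 : primeShiftForm a C / P ≤ ∑ n ∈ weilPrimeIndex a, 2 * ((Λ n : ℝ) / Real.sqrt n) := by
      rw [div_le_iff₀ hP0]; exact h1
    have h3 := weightSum_mono (show a ≤ a + h + 1 by linarith only [hh0])
    rw [hR]; exact h2.trans (h3.trans hWsum)
  set Pp := (a + h + 1) + Real.sinh (a + h + 1) with hPp
  have hPpX : Pp ≤ 2 * Real.exp 2 * X := by
    have h1 : a + h + 1 ≤ Real.exp (a + 2) := by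
      have := Real.add_one_le_exp (a + 2); linarith only [this, hh1]
    have h2 : Real.sinh (a + h + 1) ≤ Real.exp (a + 2) := by
      rw [Real.sinh_eq]
      have := Real.exp_le_exp.2 (show a + h + 1 ≤ a + 2 by linarith only [hh1])
      linarith only [this, Real.exp_pos (-(a + h + 1)), Real.exp_pos (a + 2)]
    have h3 : Real.exp (a + 2) = X * Real.exp 2 := by rw [hX, ← Real.exp_add]
    rw [hPp]; linarith only [h1, h2, h3]
  have hPp0 : 0 ≤ Pp := by
    rw [hPp]; have := Real.sinh_pos_iff.2 (show 0 < a + h + 1 by linarith only [ha4, hh0]); linarith only [this, ha4, hh0]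
  /- ─── the complement ceiling `L ≤ 12a + 11` and the largeness conditions ─── -/
  have hΨ : weilArchTail (η * (h / 2)) ≤ 3 * a + 5 / 2 := by
    have hpos : 0 < η * (h / 2) := by positivity
    have hle : η * (h / 2) ≤ 1 := by nlinarith only [hη1, hh1, hη0, hh0]
    have h1 := weilArchTail_le_half_log hpos hle
    have h2 : Real.log (1 / (η * (h / 2))) = Real.log 2 + 6 * a := by
      have ht6 : t ^ 6 = Real.exp (-(6 * a)) := by rw [ht, ← Real.exp_nat_mul]; ring_nf
      have e : 1 / (η * (h / 2)) = 2 * Real.exp (6 * a) := by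
        have h6 : η * (h / 2) = Real.exp (-(6 * a)) / 2 := by rw [hη, hh, ← ht6]; ring
        rw [h6, Real.exp_neg]; field_simp
      rw [e, Real.log_mul (by norm_num) (Real.exp_pos _).ne', Real.log_exp]
    rw [h2] at h1
    have h3 : Real.log 2 ≤ 1 := by
      have := Real.log_two_lt_d9; linarith only [this]
    linarith only [h1, h3]
  set L := 4 * (P + 3) * s ^ 2 + 8 * (h + h / 16) * Pp + 4 * weilArchTail (η * (h / 2)) with hL
  have hLle : L ≤ 12 * a + 11 := by
    -- `4(P+3)s² ≤ 20X·t⁶ ≤ 20t`, `8(h + h/16)Pp ≤ (17/2)t⁴·2e²X ≤ 17e²t`, `t < c ≤ 1/2000`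
    have h1 : 4 * (P + 3) * s ^ 2 ≤ 20 * t := by
      have e : 4 * (P + 3) * s ^ 2 = 4 * (P + 3) * t * t ^ 5 := by rw [hs]; ring
      rw [e]
      have h2 : (P + 3) * t ≤ 5 := by
        have := mul_le_mul_of_nonneg_right hPX ht0.le
        rw [mul_assoc, hXt] at this; linarith only [this]
      have h3 : t ^ 5 ≤ t := pow_le_of_le_one ht0.le ht1 (by norm_num)
      have h4 : 0 ≤ 4 * (P + 3) * t := by positivity
      nlinarith only [h2, h3, h4, ht0]
    have h2 : 8 * (h + h / 16) * Pp ≤ 17 * Real.exp 2 * t := by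
      have e : 8 * (h + h / 16) * Pp = 17 / 2 * (Pp * t) * t ^ 3 := by rw [hh]; ring
      rw [e]
      have h3 : Pp * t ≤ 2 * Real.exp 2 := by
        have := mul_le_mul_of_nonneg_right hPpX ht0.le
        rw [mul_assoc, hXt] at this; linarith only [this]
      have h4 : t ^ 3 ≤ t := pow_le_of_le_one ht0.le ht1 (by norm_num)
      have h5 : 0 ≤ Pp * t := by positivity
      nlinarith only [h3, h4, h5, ht0, Real.exp_pos (2:ℝ)]
    have h3 : (20 + 17 * Real.exp 2) * t ≤ 1 := by nlinarith only [he8, htc, hcsmall, ht0]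
    rw [hL]; linarith only [h1, h2, h3, hΨ]
  have hL12 : L ≤ 12 * (a ^ 3 + 1) := by linarith only [hLle, ha3]
  -- `12(a³+1) ≤ 12c·X ≤ X·(6/1000)·ε'δ`, hence `L + 1 ≤ R` and `3L ≤ δR`
  have haX3 : a ^ 3 + 1 ≤ c * X := by
    have e : a ^ 3 + 1 = (a ^ 3 + 1) * t * X := by rw [mul_assoc, mul_comm t, hXt, mul_one]
    rw [e]; exact mul_le_mul_of_nonneg_right hct.le hX0.le
  have hgap : L + 1 ≤ R := by
    have h1 : 13 * (a ^ 3 + 1) ≤ 13 * (c * X) := by linarith only [haX3]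
    have h2 : 13 * (c * X) ≤ X / 2 := by nlinarith only [hcsmall, hX0]
    have h3 : L + 1 ≤ 13 * (a ^ 3 + 1) := by linarith only [hL12, ha31]
    linarith only [h1, h2, h3, hRX]
  have h3L : 3 * L ≤ δ * R := by
    have h1 : 3 * L ≤ 36 * (c * X) := by linarith only [hL12, haX3]
    have h2 : 36 * (c * X) ≤ δ * (X / 2) := by
      have : 36 * c ≤ δ / 2 := by nlinarith only [hc1, hε'1, hδ0, hε'0]
      nlinarith only [this, hX0]
    have h3 : δ * (X / 2) ≤ δ * R := mul_le_mul_of_nonneg_left hRX hδ0.le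
    linarith only [h1, h2, h3]
  have h12s : 12 * s ≤ δ := by
    have : s ≤ c := hst.trans htc.le
    have : 12 * c ≤ δ := by nlinarith only [hc1, hε'1, hδ0, hε'0]
    linarith only [hst, htc, this]
  /- ─── the floor estimate with these budgets ─── -/
  set J := (∫ x in Ioo (-a) a, ((∑ n ∈ weilPrimeIndex a, (Λ n : ℝ) / Real.sqrt n *
      (C (x - Real.log n) + C (x + Real.log n))) - R * C x) ^ 2) / P with hJ
  have hI0 : 0 ≤ ∫ x in Ioo (-a) a, ((∑ n ∈ weilPrimeIndex a, (Λ n : ℝ) / Real.sqrt n *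
      (C (x - Real.log n) + C (x + Real.log n))) - R * C x) ^ 2 :=
    setIntegral_nonneg measurableSet_Ioo fun x _ ↦ sq_nonneg _
  have hJ0 : 0 ≤ J := by rw [hJ]; exact div_nonneg hI0 hP0.le
  have hcoup : ∫ x in Ioo (-a) a, ((∑ n ∈ weilPrimeIndex a, (Λ n : ℝ) / Real.sqrt n *
      (C (x - Real.log n) + C (x + Real.log n))) - R * C x) ^ 2 ≤ J * (a + Real.sinh a) := by
    rw [hJ, ← hP, div_mul_cancel₀ _ hP0.ne']
  have hgap' : 4 * (a + Real.sinh a + 3) * s ^ 2 + 8 * (h + h / 16) * Pp + 4 * weilArchTail (η * (h / 2)) + 1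
      ≤ primeShiftForm a ((Icc (-a) a).indicator (fun y ↦ Real.cosh (y / 2))) / (a + Real.sinh a) := by
    rw [← hCdef, ← hP, ← hR]; rw [hL] at hgap; exact hgap
  have hfloor := farCoercivityFloor_le_coshQuotient_secondOrder_of_RH hRH (τ := W) (lam0 := R) ha4 hh0 hh1 hsh hη0 hη1 hs0 hs1
    hWsum hR0.le hRW hJ0 hcoup le_rfl hgap'
  rw [← hCdef, ← hP, ← hR, ← hL] at hfloor
  /- ─── the error terms ─── -/
  -- `e₁ = (3/2)s(W+W) + W√(2h + h/8) ≤ W(3s + 2η) ≤ 76e²·5·t = κt`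
  have hsqrt : Real.sqrt (2 * h + h / 8) ≤ 2 * η := by
    have h1 : 2 * h + h / 8 ≤ (2 * η) ^ 2 := by rw [hh, hη]; nlinarith only [ht0]
    calc Real.sqrt (2 * h + h / 8) ≤ Real.sqrt ((2 * η) ^ 2) := Real.sqrt_le_sqrt h1
      _ = 2 * η := Real.sqrt_sq (by positivity)
  set e₁ := 3 / 2 * s * (W + W) + W * Real.sqrt (2 * h + h / 8) with he₁
  have he₁0 : 0 ≤ e₁ := by rw [he₁]; positivity
  have he₁κ : e₁ ≤ κ * t := by
    have h1 : e₁ ≤ W * (3 * s + 2 * η) := by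
      rw [he₁]
      have := mul_le_mul_of_nonneg_left hsqrt hW0
      nlinarith only [this]
    have h2 : 3 * s + 2 * η ≤ 5 * t ^ 2 := by rw [hη] at *; linarith only [hst2]
    have h3 : W * (3 * s + 2 * η) ≤ (76 * Real.exp 2 * X) * (5 * t ^ 2) :=
      mul_le_mul hWX h2 (by positivity) (by positivity)
    have e : (76 * Real.exp 2 * X) * (5 * t ^ 2) = κ * t * (X * t) := by rw [hκ]; ring
    rw [e, hXt, mul_one] at h3
    exact h1.trans h3
  have hblock := secondOrder_asymptotic_bookkeeping (J := J) (e₁ := e₁) hδ0 hδ1 hJ0 h12s h3L hR0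
  have hblock2 : 3 / δ * e₁ ^ 2 / R ≤ 6 / δ * κ ^ 2 * t ^ 3 := by
    have h1 : e₁ ^ 2 ≤ (κ * t) ^ 2 := pow_le_pow_left₀ he₁0 he₁κ 2
    have h2 : 3 / δ * e₁ ^ 2 / R ≤ 3 / δ * (κ * t) ^ 2 / (X / 2) := by
      refine div_le_div₀ (by positivity) (mul_le_mul_of_nonneg_left h1 (by positivity)) (by positivity) hRX
    have e : 3 / δ * (κ * t) ^ 2 / (X / 2) = 6 / δ * κ ^ 2 * t ^ 3 := by
      rw [htX]; field_simp; ring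
    linarith only [h2, e.le]
  -- the small terms against `ε'·t/2`
  have hsmall1 : 6 * W * s + 11 * η ≤ (456 * Real.exp 2 + 11) * t ^ 2 := by
    have h1 : 6 * W * s ≤ 6 * (76 * Real.exp 2 * X) * s := by nlinarith only [hWX, hs0]
    have e : 6 * (76 * Real.exp 2 * X) * s = 456 * Real.exp 2 * (X * t) * t ^ 2 := by rw [hs]; ring
    rw [e, hXt, mul_one] at h1
    rw [hη] at *; linarith only [h1]
  have herr : (456 * Real.exp 2 + 11) * t ^ 2 + 6 / δ * κ ^ 2 * t ^ 3 ≤ ε' / 2 * t := by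
    -- `t < c ≤ ε'δ/10⁹`: `(456e²+11)t ≤ 3700·ε'δ/10⁹ ≤ ε'/4` and `(6/δ)κ²t² ≤ (6/δ)κ²·ε'δ/10⁹ = 6κ²ε'/10⁹ ≤ ε'/4`
    have htc2 : t ≤ ε' * δ / 10 ^ 9 := htc.le.trans hc2
    have h1 : (456 * Real.exp 2 + 11) * t ≤ ε' / 4 := by
      have h2 : (456 * Real.exp 2 + 11) * t ≤ 3700 * (ε' * δ / 10 ^ 9) := by
        have : (456 * Real.exp 2 + 11) ≤ 3700 := by linarith only [he8]
        exact mul_le_mul this htc2 ht0.le (by norm_num)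
      have h3 : 3700 * (ε' * δ / 10 ^ 9) ≤ ε' / 4 := by
        rw [mul_div_assoc']
        rw [div_le_div_iff₀ (by norm_num) (by norm_num)]
        nlinarith only [hδ1, hε'0, hδ0]
      exact h2.trans h3
    have h2 : 6 / δ * κ ^ 2 * t ^ 2 ≤ ε' / 4 := by
      have h3 : 6 / δ * κ ^ 2 * t ^ 2 ≤ 6 / δ * κ ^ 2 * t := by
        have : t ^ 2 ≤ t := pow_le_of_le_one ht0.le ht1 (by norm_num)
        exact mul_le_mul_of_nonneg_left this (by positivity)
      have h4 : 6 / δ * κ ^ 2 * t ≤ 6 / δ * κ ^ 2 * (ε' * δ / 10 ^ 9) := mul_le_mul_of_nonneg_left htc2 (by positivity)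
      have e : 6 / δ * κ ^ 2 * (ε' * δ / 10 ^ 9) = 6 * κ ^ 2 * ε' / 10 ^ 9 := by field_simp
      have h5 : 6 * κ ^ 2 * ε' / 10 ^ 9 ≤ ε' / 4 := by
        rw [div_le_div_iff₀ (by norm_num) (by norm_num)]
        nlinarith only [hκ2, hε'0]
      linarith only [h3, h4, e.le, h5]
    nlinarith only [h1, h2, ht0]
  /- ─── assemble ─── -/
  have hJR : 0 ≤ J / R := div_nonneg hJ0 hR0.le
  have hmain : R + 6 * W * s + (Real.sqrt J + e₁) ^ 2 / ((1 - 3 * s) * (R - L)) + 11 * η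
      ≤ R + (1 + ε) * J / R + ε * t := by
    have h1 : (1 + 3 * δ) * J / R ≤ (1 + ε) * J / R := by
      have : 1 + 3 * δ ≤ 1 + ε := by rw [hδ]; linarith only [hε'ε]
      rw [mul_div_assoc, mul_div_assoc]
      exact mul_le_mul_of_nonneg_right this hJR
    have h2 : ε' / 2 * t ≤ ε * t := by nlinarith only [hε'ε, ht0, hε'0]
    linarith only [hblock, hblock2, hsmall1, herr, h1, h2]
  have e : (1 + ε) * J / R = (1 + ε) * ((∫ x in Ioo (-a) a, ((∑ n ∈ weilPrimeIndex a, (Λ n : ℝ) / Real.sqrt n *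
      (C (x - Real.log n) + C (x + Real.log n))) - R * C x) ^ 2) / P) / R := by rw [hJ]
  rw [e, ht] at hmain
  rw [he₁] at hmain
  exact hfloor.trans hmain

end FloorCoshSplit

end Summit.RiemannHypothesis.RiemannHypothesis.Theorems.WeilFormatC
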